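import Summits.MatrixMultiplication.MatrixMultiplication.Theorems.FarEdgeDescentVirtualPoint
import Literature.Computability.AlgebraicComplexity.AsymptoticSumInequality
import Literature.Computability.AlgebraicComplexity.StrictAsymptoticSumInequality
import Literature.Computability.AlgebraicComplexity.PrattTripartitionBoundsProofs
import Mathlib.Analysis.SpecificLimits.Normed
import HarnessLib

/-!
# Route `FarEdgeDescent` — virtual additivity: multi-word certificates at the virtual point (kernel XXVIII)

decomp-mm ROOT cell (D-0178), lens 2 «structural dichotomy: special vs generic», gen 51.  THESES-FREE and
definition-free (imports the Theorems kernel XXVII and `Literature` only).  Sequel of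
`FarEdgeDescentVirtualPoint.lean`: there a border-rank certificate for ONE multiple word
`⟨c⟩ ⊗ ⟨a,B,a⟩` was read at a sub-tangent point `(s,t)` of the convex `y ↦ ω(1,y,1)`
(`c·a^s·B^t ≤ R̃ ≤ bR`).  Here the same is proved for an arbitrary DIRECT SUM of far-edge words
`D = ⊕ᵢ ⟨aᵢ, Bᵢ, aᵢ⟩` (`aᵢ ≥ 2`, `Bᵢ ≥ 1`; the tree's `matMulDirectSum K a B a`):

  `∑ᵢ aᵢ^s · Bᵢ^t ≤ R(D)`, `≤ R̃(D)`, `≤ bR(D)`      (`virtualSum_le_of_tensorRank_le`,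
  `virtualSum_le_asymptoticRank`, `virtualSum_le_algBorderRank`)

— Schönhage's `τ`-theorem with the cubic value `(kmn)^{ω/3}` replaced by the VIRTUAL VALUE `a^s B^t`
of a sub-tangent point, proved WITHOUT Strassen's spectral theory: expand `(∑ᵢ aᵢ^s Bᵢ^t)^N` over the
words of length `N`, group the words by type (at most `(N+1)^p` classes), bound each class
`F ⊙ ⟨K',M',K'⟩` by kernel XXVII's single-word readout and the block extraction
`R(⟨F⟩ ⊗ ⟨K',M',K'⟩) ≤ R(D^{⊗N}) ≤ R(D)^N` (tree: `tensorRank_multiple_le_kroneckerPow_matMulDirectSum`),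
and let `N → ∞` (`virtualSum_pow_le`); the asymptotic-rank form follows on the words of `D^{⊗(N+1)}`
(tree: `tensorRestrictsTo_kroneckerPow_matMulDirectSum_words`) exactly as in the tree's cubic
`sum_rpow_le_asymptoticRank_matMulDirectSum`.
CONSEQUENCE (`excess_le_of_directSum_certificates`): the EXCLUSION PRINCIPLE of kernel XXVII now accepts
MULTI-WORD certificates `bR(⊕ᵢ⟨aᵢ,Bᵢ,aᵢ⟩) ≤ r ⟹ ∑ᵢ aᵢ^s Bᵢ^t ≤ r`, a NON-LINEAR constraint on `(s,t)`
that no single abscissa reading of `ω(1,·,1)` expresses.  This is the readout through which the FULL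
word census of an anchored tower is read (cell memo NODE-g51: the crude full-class tower with clock `7`,
certifiable with the tree's one-leg augmentation `algBorderRank_innerAugment_le_of_le`, has far-edge order
`0.44861 > δ₂ = 0.40660`; the cost-free Pan–Stothers squaring tower has order `log(4/3)/log(3/2) = 0.70951`).
NO definitions (gate rule D-0009).
[cite: Blaser2013, Thm. 7.5 (proof)] [cite: AlmanDuanVassilevskaWilliamsXuXuZhou2025, Thm. 3.2]
[cite: LottiRomani1983, §2 (p. 174)] [cite: BurgisserClausenShokrollahi1997, Lemma (15.27)]
[cite: Pan1984, §16–17] [cite: Stothers2010, Thm. 8]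
-/

set_option linter.dupNamespace false

noncomputable section

open scoped BigOperators
open Filter Topology

namespace Summit.MatrixMultiplication.MatrixMultiplication.Theorems.FarEdgeDescentVirtualAdditivity

open Literature.Computability.AlgebraicComplexity
open Summit.MatrixMultiplication.MatrixMultiplication.Theorems.FarEdgeDescentVirtualPoint

variable (K : Type) [Field K] {p : ℕ} (a B : Fin p → ℕ)

/-! ## §1 One type class at the virtual point -/

/-- **One type class.**  With `D = ⊕ᵢ ⟨aᵢ,Bᵢ,aᵢ⟩`, `rep : Fin F → (Fin N → Fin p)` an injective family of
words with constant formats `∏ a = K' ≥ 2`, `∏ B = M' ≥ 1`, and `R(D^{⊗N}) ≤ R₀`: at every sub-tangent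
point `(s,t)` of `ω(1,·,1)`, `F · K'^s · M'^t ≤ R₀` (kernel XXVII's readout `F K'^s M'^t ≤ R̃(⟨F⟩⊗⟨K',M',K'⟩)`,
`R̃ ≤ R`, and block extraction). [cite: Blaser2013, Thm. 7.5 (proof)]
[cite: AlmanDuanVassilevskaWilliamsXuXuZhou2025, Thm. 3.2] -/
theorem card_mul_virtual_le_of_class {s t : ℝ}
    (hst : ∀ y : ℝ, 0 ≤ y → s + y * t ≤ omegaRect K 1 y 1)
    {N F K' M' R₀ : ℕ} (hD : tensorRank (kroneckerPow (matMulDirectSum K a B a) N) ≤ R₀)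
    (rep : Fin F → (Fin N → Fin p)) (hrep : Function.Injective rep)
    (hK : ∀ β, ∏ j, a (rep β j) = K') (hM : ∀ β, ∏ j, B (rep β j) = M')
    (hK2 : 2 ≤ K') (hM1 : 1 ≤ M') :
    (F : ℝ) * (((K' : ℕ) : ℝ) ^ s * ((M' : ℕ) : ℝ) ^ t) ≤ R₀ := by
  classical
  rcases Nat.eq_zero_or_pos F with hF0 | hFpos
  · rw [hF0, Nat.cast_zero, zero_mul]
    positivity
  have h1 := mul_rpow_mul_rpow_le_asymptoticRank K hst hFpos hK2 hM1
  have h2 : asymptoticRank (kroneckerTensor (unitTensor K F) (matMulTensor K K' M' K')) ≤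
      (tensorRank (kroneckerTensor (unitTensor K F) (matMulTensor K K' M' K')) : ℝ) :=
    asymptoticRank_le_tensorRank _
  have h3 : tensorRank (kroneckerTensor (unitTensor K F) (matMulTensor K K' M' K')) ≤ R₀ :=
    (tensorRank_multiple_le_kroneckerPow_matMulDirectSum K a B a rep hrep hK hM hK).trans hD
  have h3' : (tensorRank (kroneckerTensor (unitTensor K F) (matMulTensor K K' M' K')) : ℝ) ≤ R₀ := by
    exact_mod_cast h3
  linarith

/-! ## §2 The power bound: `(∑ᵢ aᵢ^s Bᵢ^t)^N ≤ 2 (N+1)^p R(D)^N` -/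

/-- **Power bound.**  If `aᵢ ≥ 2`, `Bᵢ ≥ 1` for all `i` and `R(⊕ᵢ⟨aᵢ,Bᵢ,aᵢ⟩) ≤ r`, then at every
sub-tangent point `(∑ᵢ aᵢ^s Bᵢ^t)^N ≤ 2 (N+1)^p r^N` for all `N` (expand over words, group by type,
`≤ (N+1)^p` classes, each `≤ r^N` by §1; the factor `2` is slack kept for uniformity with the tree's
cubic `sum_rpow_pow_le`). [cite: Blaser2013, Thm. 7.5 (proof)] -/
theorem virtualSum_pow_le {s t : ℝ} (hst : ∀ y : ℝ, 0 ≤ y → s + y * t ≤ omegaRect K 1 y 1)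
    (ha : ∀ i, 2 ≤ a i) (hB : ∀ i, 1 ≤ B i) {r : ℕ}
    (h : tensorRank (matMulDirectSum K a B a) ≤ r) (N : ℕ) :
    (∑ i, ((a i : ℕ) : ℝ) ^ s * ((B i : ℕ) : ℝ) ^ t) ^ N ≤
      2 * ((N : ℝ) + 1) ^ p * (r : ℝ) ^ N := by
  classical
  rcases Nat.eq_zero_or_pos N with hN0 | hNpos
  · subst hN0
    simp only [pow_zero, Nat.cast_zero, zero_add, one_pow, mul_one]
    norm_num
  have hD : tensorRank (kroneckerPow (matMulDirectSum K a B a) N) ≤ r ^ N :=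
    (tensorRank_kroneckerPow_le _ N).trans (Nat.pow_le_pow_left h N)
  -- the virtual value of a word
  set X : (Fin N → Fin p) → ℝ := fun τ =>
    (((∏ j, a (τ j) : ℕ) : ℝ)) ^ s * (((∏ j, B (τ j) : ℕ) : ℝ)) ^ t with hX
  have hexpand : (∑ i, ((a i : ℕ) : ℝ) ^ s * ((B i : ℕ) : ℝ) ^ t) ^ N =
      ∑ τ : Fin N → Fin p, X τ := by
    rw [Fintype.sum_pow]
    refine Finset.sum_congr rfl fun τ _ => ?_
    rw [hX]
    dsimp only
    rw [Finset.prod_mul_distrib, Real.finsetProd_rpow _ _ (fun i _ => by positivity),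
      Real.finsetProd_rpow _ _ (fun i _ => by positivity)]
    push_cast
    rfl
  -- the type of a word
  obtain ⟨wt, hwt⟩ : ∃ wt : (Fin N → Fin p) → (Fin p → Fin (N + 1)),
      ∀ τ i, ((wt τ i : Fin (N + 1)) : ℕ) = (Finset.univ.filter fun j => τ j = i).card :=
    ⟨fun τ i => ⟨(Finset.univ.filter fun j => τ j = i).card,
      Nat.lt_succ_of_le ((Finset.card_filter_le _ _).trans (by simp))⟩, fun τ i => rfl⟩
  rw [hexpand, ← Finset.sum_fiberwise Finset.univ wt X]
  -- each type class contributes at most `r^N`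
  have hclass : ∀ c : Fin p → Fin (N + 1),
      ∑ τ ∈ Finset.univ.filter (fun τ => wt τ = c), X τ ≤ (r : ℝ) ^ N := by
    intro c
    set S := Finset.univ.filter (fun τ : Fin N → Fin p => wt τ = c) with hS
    rcases S.eq_empty_or_nonempty with hemp | ⟨τ₀, hτ₀⟩
    · rw [hemp, Finset.sum_empty]
      positivity
    have hmem : ∀ τ ∈ S, ∀ i, (Finset.univ.filter fun j => τ j = i).card =
        (Finset.univ.filter fun j => τ₀ j = i).card := fun τ hτ i => by
      rw [← hwt, ← hwt, (Finset.mem_filter.1 hτ).2, (Finset.mem_filter.1 hτ₀).2]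
    have hconst : ∀ τ ∈ S, X τ = X τ₀ := fun τ hτ => by
      simp only [hX]
      rw [prod_eq_of_card_filter_eq (hmem τ hτ) a, prod_eq_of_card_filter_eq (hmem τ hτ) B]
    rw [Finset.sum_congr rfl hconst, Finset.sum_const, nsmul_eq_mul]
    -- the class as an injective family
    set rep : Fin S.card → (Fin N → Fin p) := fun β => (S.equivFin.symm β).1 with hrep
    have hrep_mem : ∀ β, rep β ∈ S := fun β => (S.equivFin.symm β).2
    have hinj : Function.Injective rep := fun β β' hβ =>
      S.equivFin.symm.injective (Subtype.ext hβ)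
    -- formats of the class: `K' = ∏ a(τ₀ j) ≥ 2`, `M' = ∏ B(τ₀ j) ≥ 1`
    have hK2 : 2 ≤ ∏ j, a (τ₀ j) := by
      have hpos : 0 < ∏ j, a (τ₀ j) := Finset.prod_pos fun j _ => by have := ha (τ₀ j); omega
      have hdvd : a (τ₀ ⟨0, hNpos⟩) ∣ ∏ j, a (τ₀ j) := Finset.dvd_prod_of_mem _ (Finset.mem_univ _)
      exact (ha _).trans (Nat.le_of_dvd hpos hdvd)
    have hM1 : 1 ≤ ∏ j, B (τ₀ j) := Nat.one_le_iff_ne_zero.2 (Finset.prod_pos fun j _ => hB (τ₀ j)).ne'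
    have hcl := card_mul_virtual_le_of_class K a B hst (R₀ := r ^ N) hD rep hinj
      (fun β => prod_eq_of_card_filter_eq (hmem _ (hrep_mem β)) a)
      (fun β => prod_eq_of_card_filter_eq (hmem _ (hrep_mem β)) B) hK2 hM1
    push_cast at hcl
    simpa [hX] using hcl
  calc ∑ c : Fin p → Fin (N + 1), ∑ τ ∈ Finset.univ.filter (fun τ => wt τ = c), X τ
      ≤ ∑ _c : Fin p → Fin (N + 1), (r : ℝ) ^ N := Finset.sum_le_sum fun c _ => hclass c
    _ = ((N : ℝ) + 1) ^ p * (r : ℝ) ^ N := by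
      rw [Finset.sum_const, Finset.card_univ, Fintype.card_fun, Fintype.card_fin, Fintype.card_fin,
        nsmul_eq_mul]
      push_cast
      ring
    _ ≤ 2 * ((N : ℝ) + 1) ^ p * (r : ℝ) ^ N := by
      have : (0 : ℝ) ≤ ((N : ℝ) + 1) ^ p * (r : ℝ) ^ N := by positivity
      linarith

/-! ## §3 The virtual `τ`-theorem for the rank -/

/-- **Virtual `τ`-theorem, rank version.**  If `aᵢ ≥ 2`, `Bᵢ ≥ 1` and `R(⊕ᵢ⟨aᵢ,Bᵢ,aᵢ⟩) ≤ r`, then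
`∑ᵢ aᵢ^s Bᵢ^t ≤ r` at every sub-tangent point `(s,t)` of `ω(1,·,1)` (`S^N ≤ 2(N+1)^p r^N` for all `N`
forces `S ≤ r`). [cite: Blaser2013, Thm. 7.5] -/
theorem virtualSum_le_of_tensorRank_le {s t : ℝ}
    (hst : ∀ y : ℝ, 0 ≤ y → s + y * t ≤ omegaRect K 1 y 1)
    (ha : ∀ i, 2 ≤ a i) (hB : ∀ i, 1 ≤ B i) {r : ℕ}
    (h : tensorRank (matMulDirectSum K a B a) ≤ r) :
    ∑ i, ((a i : ℕ) : ℝ) ^ s * ((B i : ℕ) : ℝ) ^ t ≤ r := by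
  set S : ℝ := ∑ i, ((a i : ℕ) : ℝ) ^ s * ((B i : ℕ) : ℝ) ^ t with hS
  have hS0 : 0 ≤ S := Finset.sum_nonneg fun i _ => by positivity
  have hpow := virtualSum_pow_le K a B hst ha hB h
  by_contra hlt
  rw [not_le] at hlt
  rcases Nat.eq_zero_or_pos r with hr | hr
  · have h1 : S ^ 1 ≤ 2 * (((1 : ℕ) : ℝ) + 1) ^ p * (r : ℝ) ^ 1 := hpow 1
    rw [hr] at h1 hlt
    simp only [pow_one, Nat.cast_zero, mul_zero] at h1 hlt
    exact absurd h1 (not_le.2 hlt)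
  · have hr0 : (0 : ℝ) < r := by exact_mod_cast hr
    set c : ℝ := S / r with hc
    have hc1 : 1 < c := (one_lt_div hr0).2 hlt
    have hc0 : 0 < c := zero_lt_one.trans hc1
    have hSc : S = c * r := by rw [hc, div_mul_cancel₀ _ hr0.ne']
    have hpow' : ∀ N : ℕ, c ^ N ≤ 2 * ((N : ℝ) + 1) ^ p := by
      intro N
      have h1 : S ^ N ≤ 2 * ((N : ℝ) + 1) ^ p * (r : ℝ) ^ N := hpow N
      rw [hSc, mul_pow] at h1
      exact le_of_mul_le_mul_right (by linarith) (pow_pos hr0 N)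
    have hlim : Tendsto (fun N : ℕ => (((N + 1 : ℕ) : ℝ)) ^ p / c ^ (N + 1)) atTop (𝓝 0) :=
      (tendsto_pow_const_div_const_pow_of_one_lt p hc1).comp (tendsto_add_atTop_nat 1)
    have hsmall : (0 : ℝ) < 1 / (2 * c) := by positivity
    obtain ⟨N, hN⟩ := (hlim.eventually (gt_mem_nhds hsmall)).exists
    rw [div_lt_div_iff₀ (by positivity) (by positivity), one_mul, pow_succ] at hN
    have h2 := mul_le_mul_of_nonneg_right (hpow' N) hc0.le
    push_cast at hN
    linarith

/-! ## §4 The virtual `τ`-theorem for the asymptotic rank and the border rank -/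

/-- `∑_w (∏ⱼ a_{wⱼ})^s (∏ⱼ B_{wⱼ})^t = (∑ᵢ aᵢ^s Bᵢ^t)^N` over the words `w ∈ [p]^N ≅ Fin (p^N)`
(the virtual value is multiplicative). [folklore] -/
theorem sum_words_virtual (s t : ℝ) (N : ℕ) :
    (∑ w : Fin (p ^ N),
        (((∏ j, a (finFunctionFinEquiv.symm w j) : ℕ) : ℝ)) ^ s *
          (((∏ j, B (finFunctionFinEquiv.symm w j) : ℕ) : ℝ)) ^ t) =
      (∑ i, ((a i : ℕ) : ℝ) ^ s * ((B i : ℕ) : ℝ) ^ t) ^ N := by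
  rw [← sum_words_prod (fun i => ((a i : ℕ) : ℝ) ^ s * ((B i : ℕ) : ℝ) ^ t) N]
  refine Finset.sum_congr rfl fun w _ => ?_
  rw [Finset.prod_mul_distrib, Real.finsetProd_rpow _ _ (fun i _ => by positivity),
    Real.finsetProd_rpow _ _ (fun i _ => by positivity)]
  push_cast
  rfl

/-- **Virtual `τ`-theorem, asymptotic-rank version**: `∑ᵢ aᵢ^s Bᵢ^t ≤ R̃(⊕ᵢ⟨aᵢ,Bᵢ,aᵢ⟩)` for `aᵢ ≥ 2`,
`Bᵢ ≥ 1` at every sub-tangent point (`S^{N+1} = S(words_{N+1}) ≤ R(words_{N+1}) ≤ R(D^{⊗(N+1)})` by §3 on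
the words, which are again far-edge words with `∏ a ≥ 2`; then `R̃(D) = inf_N R(D^{⊗(N+1)})^{1/(N+1)}`).
[cite: Blaser2013, Thm. 7.5] [cite: AlmanDuanVassilevskaWilliamsXuXuZhou2025, Thm. 3.1] -/
theorem virtualSum_le_asymptoticRank {s t : ℝ}
    (hst : ∀ y : ℝ, 0 ≤ y → s + y * t ≤ omegaRect K 1 y 1)
    (ha : ∀ i, 2 ≤ a i) (hB : ∀ i, 1 ≤ B i) :
    ∑ i, ((a i : ℕ) : ℝ) ^ s * ((B i : ℕ) : ℝ) ^ t ≤ asymptoticRank (matMulDirectSum K a B a) := by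
  classical
  set S : ℝ := ∑ i, ((a i : ℕ) : ℝ) ^ s * ((B i : ℕ) : ℝ) ^ t with hS
  have hS0 : 0 ≤ S := Finset.sum_nonneg fun i _ => by positivity
  refine le_ciInf fun N => ?_
  -- the words of length `N+1` are far-edge words with `∏ a ≥ 2`, `∏ B ≥ 1`
  have ha' : ∀ w : Fin (p ^ (N + 1)), 2 ≤ ∏ j, a (finFunctionFinEquiv.symm w j) := by
    intro w
    have hpos : 0 < ∏ j, a (finFunctionFinEquiv.symm w j) :=
      Finset.prod_pos fun j _ => by have := ha (finFunctionFinEquiv.symm w j); omega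
    have hdvd : a (finFunctionFinEquiv.symm w 0) ∣ ∏ j, a (finFunctionFinEquiv.symm w j) :=
      Finset.dvd_prod_of_mem _ (Finset.mem_univ _)
    exact (ha _).trans (Nat.le_of_dvd hpos hdvd)
  have hB' : ∀ w : Fin (p ^ (N + 1)), 1 ≤ ∏ j, B (finFunctionFinEquiv.symm w j) := fun w =>
    Nat.one_le_iff_ne_zero.2 (Finset.prod_pos fun j _ => hB (finFunctionFinEquiv.symm w j)).ne'
  have hW := virtualSum_le_of_tensorRank_le K
    (fun w : Fin (p ^ (N + 1)) => ∏ j, a (finFunctionFinEquiv.symm w j))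
    (fun w => ∏ j, B (finFunctionFinEquiv.symm w j)) hst ha' hB'
    ((tensorRestrictsTo_kroneckerPow_matMulDirectSum_words K a B a (N + 1)).tensorRank_le)
  rw [sum_words_virtual a B s t (N + 1)] at hW
  -- `S^{N+1} ≤ R(D^{⊗(N+1)})`, take `(N+1)`-th roots
  have h := Real.rpow_le_rpow (pow_nonneg hS0 (N + 1)) hW (by positivity : (0 : ℝ) ≤ ((N : ℝ) + 1)⁻¹)
  rwa [← Real.rpow_natCast, ← Real.rpow_mul hS0, show ((N + 1 : ℕ) : ℝ) * ((N : ℝ) + 1)⁻¹ = 1 by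
    push_cast; field_simp, Real.rpow_one] at h

/-- **Virtual `τ`-theorem, border-rank version**: a certificate `bR(⊕ᵢ⟨aᵢ,Bᵢ,aᵢ⟩) ≤ r` (`aᵢ ≥ 2`,
`Bᵢ ≥ 1`) forces `∑ᵢ aᵢ^s Bᵢ^t ≤ r` at every sub-tangent point of `ω(1,·,1)` (`R̃ ≤ bR`).
[cite: BurgisserClausenShokrollahi1997, Lemma (15.27)] [cite: Blaser2013, Thm. 7.5] -/
theorem virtualSum_le_algBorderRank {s t : ℝ}
    (hst : ∀ y : ℝ, 0 ≤ y → s + y * t ≤ omegaRect K 1 y 1)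
    (ha : ∀ i, 2 ≤ a i) (hB : ∀ i, 1 ≤ B i) {r : ℕ}
    (hr : algBorderRank (matMulDirectSum K a B a) ≤ r) :
    ∑ i, ((a i : ℕ) : ℝ) ^ s * ((B i : ℕ) : ℝ) ^ t ≤ r := by
  classical
  exact (virtualSum_le_asymptoticRank K a B hst ha hB).trans (asymptoticRank_le_of_algBorderRank_le hr)

/-! ## §5 The exclusion principle with multi-word certificates -/

/-- **EXCLUSION BY DIRECT-SUM CERTIFICATES.**  To bound the far-edge excess `ω(1,x₀,1) − (x₀+1)` by `η`
it suffices that every `(s,t) ∈ [1,2]×[0,1]` obeying ALL direct-sum certificate inequalities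
`bR(⊕ᵢ⟨aᵢ,Bᵢ,aᵢ⟩) ≤ r ⟹ ∑ᵢ aᵢ^s Bᵢ^t ≤ r` (`aᵢ ≥ 2`, `Bᵢ ≥ 1`, any number `p` of words) has
`(s−1) − x₀(1−t) ≤ η`.  [cite: LottiRomani1983, §2 (p. 174)] [cite: Blaser2013, Thm. 7.5] -/
theorem excess_le_of_directSum_certificates {x₀ η : ℝ} (hx₀ : 0 < x₀)
    (h : ∀ s t : ℝ, 0 ≤ t → t ≤ 1 → 1 ≤ s → s ≤ 2 →
      (∀ (p : ℕ) (a B : Fin p → ℕ) (r : ℕ), (∀ i, 2 ≤ a i) → (∀ i, 1 ≤ B i) →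
          algBorderRank (matMulDirectSum K a B a) ≤ r →
          ∑ i, ((a i : ℕ) : ℝ) ^ s * ((B i : ℕ) : ℝ) ^ t ≤ r) →
      (s - 1) - x₀ * (1 - t) ≤ η) :
    omegaRect K 1 x₀ 1 - (x₀ + 1) ≤ η :=
  excess_le_of_virtualPoints K hx₀ fun s t ht0 ht1 hs1 hs2 hsup =>
    h s t ht0 ht1 hs1 hs2 fun _ a B _ ha hB hr => virtualSum_le_algBorderRank K a B hsup ha hB hr

end Summit.MatrixMultiplication.MatrixMultiplication.Theorems.FarEdgeDescentVirtualAdditivity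

end
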